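import Summits.AnomalousDissipation.AnomalousDissipation.Theorems.MarginalStabilityChainStrainedLayerLawTranslate
import Literature.Analysis.FluidPDE.StretchedLayerEnergyRigidity

/-!
# The registered stub `stub_velocityRigidity` of the line `contraction-capture` in the ENERGY CLASS
# (crux stmt-AnomalousDissipation-3007, `MarginalStabilityChain.StrainedLayerLaw`)

The registered stub `stub_velocityRigidity` (an `nℓ`-periodic member of the crux's BARE class `InClass` from
`ℓ`-periodic admissible data has `ℓ`-periodic velocity) is, in content, uniqueness of the velocity in the bare class
(`velocityRigidity_of_unique`, landed in `…StrainedLayerLawTranslate.lean`) — OPEN there (no growth class; refuter notes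
M1/M3). This file records the kernel-checked CONDITIONAL closure that the route-level repair recommended by every analyst of
the crux would give: if the solution additionally has energy-class tails `StretchedLayer.HasLayerEnergyTails u v`
(bounded `u, v, ∂_y(u,v)`, `|∂ₓ(u,v)| ≤ C e^{−k|y|}` uniformly on `(0,T]`; bounded `∂ₜ(u,v)` and pure second slice
derivatives on `[δ,T]`), then the stub's conclusion holds — by the landed Literature theorem
`IsStretchedLayerNSSolutionOn.periodic_of_hasLayerEnergyTails` (Majda–Bertozzi-type energy estimate for the shift
difference on the period strip; `Literature/Analysis/FluidPDE/StretchedLayerEnergyRigidity.lean`).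

So: appending `HasLayerEnergyTails u v` (written with the crux's `Dt/Dx/Dy` lets) to the hypothesis list of
`StrainedLayerLaw` closes stub 1a of the line outright; every other stub survives verbatim. Also here: `InClass.isSolution`
(a member of the crux's class is a solution of the Literature structure on `(0, ∞)` with `γ = ΔU = 1`).
-/

-- `Summit.<Summit>.<Problem>` is the tree's mandated summit-side namespace (CONVENTIONS §2); for this
-- single-conjunct summit the two coincide, so the duplicate is deliberate.
set_option linter.dupNamespace false

noncomputable section

open scoped BigOperators Topology ENNReal
open Filter Set Function MeasureTheory

namespace Summit.AnomalousDissipation.AnomalousDissipation.Theorems.StrainedLayerLaw.ContractionCapture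

open Literature.Analysis.FluidPDE Literature.Analysis.FluidPDE.StretchedLayer
open Summit.AnomalousDissipation.AnomalousDissipation.Theses.MarginalStabilityChain

/-- A member of the crux's class is a classical solution of the Literature structure
`IsStretchedLayerNSSolutionOn` on the open time set `(0, ∞)` with `γ = ΔU = 1`: the crux's two-sided `deriv` in `t` is the
one-sided `dT (Ioi 0)` there (`dT_of_isOpen`), `1 * y = y`, and the slice derivatives agree definitionally. [folklore] -/
theorem InClass.isSolution {ν L : ℝ} {θ₁ θ₂ : ℝ → ℝ → ℝ} {u v p : ℝ → ℝ → ℝ → ℝ}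
    (h : InClass ν L θ₁ θ₂ u v p) : IsStretchedLayerNSSolutionOn (Ioi 0) ν 1 1 L u v p := by
  obtain ⟨hu, hv, hp, -, -, hpde, hper, hfar, -⟩ := h
  refine
    { contDiffOn_u := hu
      contDiffOn_v := hv
      contDiffOn_p := hp
      momentum_x := ?_
      momentum_y := ?_
      divFree := fun t ht x y => (hpde t x y ht).2.2
      periodic_u := fun t ht x y => (hper t x y (le_of_lt ht)).1
      periodic_v := fun t ht x y => (hper t x y (le_of_lt ht)).2.1
      periodic_p := fun t ht x y => (hper t x y (le_of_lt ht)).2.2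
      tendsto_u_atTop := fun t ht x => (hfar t x (le_of_lt ht)).1
      tendsto_u_atBot := fun t ht x => (hfar t x (le_of_lt ht)).2.1
      tendsto_v_atTop := fun t ht x => (hfar t x (le_of_lt ht)).2.2.1
      tendsto_v_atBot := fun t ht x => (hfar t x (le_of_lt ht)).2.2.2 }
  · intro t ht x y
    rw [dT_of_isOpen isOpen_Ioi u ht, one_mul]
    exact (hpde t x y ht).1
  · intro t ht x y
    rw [dT_of_isOpen isOpen_Ioi v ht, one_mul, one_mul]
    exact (hpde t x y ht).2.1

/-- **Stub 1a in the energy class (conditional closure of `stub_velocityRigidity`).** If `θ` is admissible with period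
`ℓ`, `(u, v, p)` is in the crux's class with period `nℓ` (`n ≥ 1`, `ν > 0`) from `U_B^ν + θ`, AND the velocity has
energy-class tails `HasLayerEnergyTails u v`, then `u, v` are `ℓ`-periodic in `x` for every `t ≥ 0`. Proof: the class
member is a solution of the Literature structure on `(0,∞)` (`InClass.isSolution`), is continuous up to `t = 0` (class
clauses), its datum is `ℓ`-periodic (`velocityRigidity_time_zero`), so the landed energy-class period rigidity
`IsStretchedLayerNSSolutionOn.periodic_of_hasLayerEnergyTails` applies (with `γ = ΔU = 1`). [folklore] -/
theorem velocityRigidity_of_hasLayerEnergyTails {ν ℓ : ℝ} {n : ℕ} {θ₁ θ₂ : ℝ → ℝ → ℝ} {u v p : ℝ → ℝ → ℝ → ℝ}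
    (hν : 0 < ν) (hℓ : 0 < ℓ) (hn : 1 ≤ n) (hθ : IsAdmissiblePerturbation ℓ θ₁ θ₂)
    (h : InClass ν (n * ℓ) θ₁ θ₂ u v p) (hE : HasLayerEnergyTails u v) :
    ∀ t x y : ℝ, 0 ≤ t → u t (x + ℓ) y = u t x y ∧ v t (x + ℓ) y = v t x y := by
  have hsol : IsStretchedLayerNSSolutionOn (Ioi 0) ν 1 1 (n * ℓ) u v p := h.isSolution
  have h0 : ∀ x y : ℝ, u 0 (x + ℓ) y = u 0 x y ∧ v 0 (x + ℓ) y = v 0 x y :=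
    fun x y => velocityRigidity_time_zero hθ h x y
  have h' := h
  dsimp only [InClass] at h'
  obtain ⟨-, -, -, hu0, hv0, -⟩ := h'
  exact hsol.periodic_of_hasLayerEnergyTails hν.le zero_le_one hℓ hn hu0 hv0 h0 hE

end Summit.AnomalousDissipation.AnomalousDissipation.Theorems.StrainedLayerLaw.ContractionCapture

end
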